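import Literature.Barriers.MatrixMultiplication.UniversalMethodBarrierCwCount
import Literature.Barriers.MatrixMultiplication.UniversalMethodBarrierThm29
import Literature.Barriers.MatrixMultiplication.UniversalMethodBarrierAsymptoticRank
import HarnessLib

/-!
# The Universal Method bound for `CW_q` from a finite slice-rank base — proved

Topic `Literature/Barriers/MatrixMultiplication`; part of the PROOF of `UniversalMethodBarrier`
(Alman 2021), milestone "Thm. 1.3". Alman (§4.1) applies Thm. 2.9 to `CW_q` with
`R̃(CW_q) ≥ q + 2` and his bound on `S̃(CW_q)`. Since the vendored `S̃` is a supremum (for which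
that bound fails at small powers, e.g. `S(CW_1) = 3`), the Thm. 2.9 argument is re-run here with the
finite form `S(T^{⊗e}) ≤ 6 (e+1)³ Bᵉ` (from `sliceRank_cwPow_le`), the polynomial factor being
absorbed as `N → ∞` exactly like `(N+1)^p`. Everything PROVED.

## Content

* `flatteningRank_bigCwTensor` (`ζ⁽¹⁾(CW_q) = q+2`: the slices are linearly independent),
  `le_asymptoticRank_bigCwTensor` (**`R̃(CW_q) ≥ q + 2`**), `isVariableSymmetric_bigCwTensor`.
* `sum_rpow_pow_le_of_sliceRank_pow_le` — the core estimate of the proof of Thm. 2.9 with a finite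
  base: `(Σᵢ (aᵢbᵢcᵢ)^{w/3})^N ≤ 45 n² (N+1)^{p+2} (B^{w/2})^{Nn}`;
  `asymptoticRank_le_rpow_of_qualifying` — a qualifying `w` forces `R̃(t) ≤ B^{w/2}`.
* `min_le_universalOmega_bigCwTensor` — **`ω_u(CW_q) ≥ min(3, 2 log(q+2) / log B)`** for every
  `B > 1` with `g_q ≤ B` on `[0, 1/3]` (Alman §4.1: "`ω_u(CW_q) ≥ 2 log(q+2)/log S̃(CW_q)`").

## References

* J. Alman, Theory of Computing 17 (2021), Thm. 2.9 (proof), §4.1 (pp. 20–21). [Alman2021]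
-/

noncomputable section

open scoped BigOperators

namespace Literature.Barriers.MatrixMultiplication

open Literature.Computability.AlgebraicComplexity
open Filter Topology

universe u

/-! ## `R̃(CW_q) ≥ q + 2` -/

section Flattening

variable {K : Type u} [Field K]

/-- The `q+2` slices of `CW_q` are linearly independent (evaluate at `(y₀, z_{q+1})`, `(y₀, z₀)`,
`(y₀, z_i)`), so `ζ⁽¹⁾(CW_q) = q + 2` (Alman 2021, §4.1: "`R̃(CW_{q,σ}) ≥ q + 2`").
[cite: Alman2021, §4.1] -/
theorem flatteningRank_bigCwTensor (q : ℕ) : flatteningRank (bigCwTensor K q) = q + 2 := by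
  have hl : (Fin.last (q + 1) : Fin (q + 2)) ≠ 0 := by simp [Fin.ext_iff]
  have hli : LinearIndependent K (xSlices (bigCwTensor K q)) := by
    rw [Fintype.linearIndependent_iff]
    intro g hg a
    have hev : ∀ b c : Fin (q + 2), (∑ i, g i * bigCwTensor K q i b c) = 0 := by
      intro b c
      have := congrFun hg (b, c)
      simpa [Finset.sum_apply, Pi.smul_apply, xSlices_apply, smul_eq_mul] using this
    by_cases ha0 : a = 0
    · subst ha0
      have h := hev 0 (Fin.last (q + 1))
      rw [Finset.sum_eq_single (0 : Fin (q + 2))] at h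
      · simpa [bigCwTensor_apply, hl, hl.symm] using h
      · intro i _ hi
        simp [bigCwTensor_apply, hi, hl, hl.symm]
      · simp
    by_cases hal : a = Fin.last (q + 1)
    · subst hal
      have h := hev 0 0
      rw [Finset.sum_eq_single (Fin.last (q + 1) : Fin (q + 2))] at h
      · simpa [bigCwTensor_apply, hl, hl.symm] using h
      · intro i _ hi
        simp [bigCwTensor_apply, hi, hl.symm]
      · simp
    · have h := hev 0 a
      rw [Finset.sum_eq_single a] at h
      · simpa [bigCwTensor_apply, ha0, hal, hl, hl.symm] using h
      · intro i _ hi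
        simp [bigCwTensor_apply, hi, ha0, hal, hl.symm]
      · simp
  unfold flatteningRank
  rw [finrank_span_eq_card hli, Fintype.card_fin]

/-- **`R̃(CW_q) ≥ q + 2`** (flattening rank). [cite: Alman2021, §4.1] -/
theorem le_asymptoticRank_bigCwTensor (q : ℕ) : ((q : ℝ) + 2) ≤ asymptoticRank (bigCwTensor K q) := by
  have := flatteningRank_le_asymptoticRank (bigCwTensor K q)
  rw [flatteningRank_bigCwTensor] at this
  exact_mod_cast this

/-- `CW_q` is variable-symmetric. [cite: Alman2021, §4.1] -/
theorem isVariableSymmetric_bigCwTensor (q : ℕ) : IsVariableSymmetric (bigCwTensor K q) := by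
  intro a b c
  simp only [bigCwTensor_apply]
  refine if_congr ?_ rfl rfl
  constructor
  · rintro (⟨h1, h2, h3, h4⟩ | ⟨h1, h2, h3, h4⟩ | ⟨h1, h2, h3, h4⟩ | ⟨h1, h2, h3⟩ | ⟨h1, h2, h3⟩ | ⟨h1, h2, h3⟩)
    · exact Or.inr (Or.inr (Or.inl ⟨h1, h2, h3, h4⟩))
    · exact Or.inl ⟨h1, h2.symm, fun h => h3 (h2.trans h), fun h => h4 (h2.trans h)⟩
    · exact Or.inr (Or.inl ⟨h1, h2.symm, fun h => h3 (h2.trans h), fun h => h4 (h2.trans h)⟩)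
    · exact Or.inr (Or.inr (Or.inr (Or.inr (Or.inl ⟨h2, h3, h1⟩))))
    · exact Or.inr (Or.inr (Or.inr (Or.inr (Or.inr ⟨h2, h3, h1⟩))))
    · exact Or.inr (Or.inr (Or.inr (Or.inl ⟨h2, h3, h1⟩)))
  · rintro (⟨h1, h2, h3, h4⟩ | ⟨h1, h2, h3, h4⟩ | ⟨h1, h2, h3, h4⟩ | ⟨h1, h2, h3⟩ | ⟨h1, h2, h3⟩ | ⟨h1, h2, h3⟩)
    · exact Or.inr (Or.inl ⟨h1, h2.symm, fun h => h3 (h2.trans h), fun h => h4 (h2.trans h)⟩)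
    · exact Or.inr (Or.inr (Or.inl ⟨h1, h2.symm, fun h => h3 (h2.trans h), fun h => h4 (h2.trans h)⟩))
    · exact Or.inl ⟨h1, h2, h3, h4⟩
    · exact Or.inr (Or.inr (Or.inr (Or.inr (Or.inr ⟨h3, h1, h2⟩))))
    · exact Or.inr (Or.inr (Or.inr (Or.inl ⟨h3, h1, h2⟩)))
    · exact Or.inr (Or.inr (Or.inr (Or.inr (Or.inl ⟨h3, h1, h2⟩))))

end Flattening

/-! ## The core estimate with a finite slice-rank base -/

section Core

variable (K : Type) [Field K] {ι : Type} [Fintype ι] [DecidableEq ι]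

/-- **Core estimate, finite slice-rank form**: as `sum_rpow_pow_le_asymptoticSliceRank`, but with
`S̃(t)^e` replaced by a hypothesis `S(t^{⊗e}) ≤ 6 (e+1)³ Bᵉ` (`B ≥ 1`); the polynomial factor is
absorbed: `(Σᵢ (aᵢbᵢcᵢ)^{w/3})^N ≤ 45 n² (N+1)^{p+2} (B^{w/2})^{Nn}`. This is the form of Alman's
Thm. 2.9 argument that his Thm. 3.4 actually feeds (a bound `S(T^{⊗n}) ≤ B^{n+o(n)}`, not a bound
on the supremum `S̃`). [cite: Alman2021, Thm. 2.9 (proof)] -/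
theorem sum_rpow_pow_le_of_sliceRank_pow_le (t : ι → ι → ι → K) (ht : IsVariableSymmetric t)
    {n : ℕ} (hn : 0 < n) {p : ℕ} {a b c : Fin p → ℕ} (hpos : ∀ i, 0 < a i ∧ 0 < b i ∧ 0 < c i)
    (hdeg : PolyDegeneratesTo (kroneckerPow t n) (matMulDirectSum K a b c)) {w : ℝ}
    (hw : w ∈ Set.Icc (2 : ℝ) 3) {B : ℝ} (hB1 : 1 ≤ B)
    (hS : ∀ e : ℕ, 0 < e → (sliceRank (kroneckerPow t e) : ℝ) ≤ 6 * ((e : ℝ) + 1) ^ 3 * B ^ e) (N : ℕ) :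
    (∑ i, ((a i * b i * c i : ℕ) : ℝ) ^ (w / 3)) ^ N ≤
      45 * (n : ℝ) ^ 2 * ((N : ℝ) + 1) ^ (p + 2) * (B ^ (w / 2)) ^ (N * n) := by
  have hB0 : 0 ≤ B := zero_le_one.trans hB1
  have hn1 : (1 : ℝ) ≤ n := by exact_mod_cast hn
  rcases Nat.eq_zero_or_pos N with hN0 | hN
  · subst hN0
    simp only [pow_zero, Nat.cast_zero, zero_add, one_pow, mul_one, zero_mul]
    nlinarith
  obtain ⟨F, A, B', C, hA, hB', hC, hres, hineq⟩ := exists_typeClass K a b c (w / 3) N hpos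
  have h₁ : PolyDegeneratesTo (kroneckerPow t (N * n))
      (kroneckerTensor (unitTensor K F) (matMulTensor K A B' C)) :=
    (tensorRestrictsTo_kroneckerPow_mul t N n).trans_polyDegeneratesTo
      ((hdeg.kroneckerPow N).trans_restrictsTo hres)
  have ht₁ := ht.kroneckerPow (N * n)
  have h₂ : PolyDegeneratesTo (kroneckerPow t (N * n))
      (kroneckerTensor (unitTensor K F) (matMulTensor K B' C A)) :=
    (ht₁.polyDegeneratesTo_rotate h₁).trans_restrictsTo
      (tensorRestrictsTo_rotate_multiple_matMulTensor K F A B' C)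
  have h₃ : PolyDegeneratesTo (kroneckerPow t (N * n))
      (kroneckerTensor (unitTensor K F) (matMulTensor K C A B')) :=
    (ht₁.polyDegeneratesTo_rotate h₂).trans_restrictsTo
      (tensorRestrictsTo_rotate_multiple_matMulTensor K F B' C A)
  set Mabc := A * B' * C with hM
  have hfin : PolyDegeneratesTo (kroneckerPow t (N * n + (N * n + N * n)))
      (kroneckerTensor (unitTensor K (F ^ 3)) (matMulTensor K Mabc Mabc Mabc)) := by
    have s1 : TensorRestrictsTo (kroneckerPow t (N * n + (N * n + N * n)))
        (kroneckerTensor (kroneckerPow t (N * n))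
          (kroneckerTensor (kroneckerPow t (N * n)) (kroneckerPow t (N * n)))) :=
      (tensorRestrictsTo_kroneckerPow_add t _ _).trans
        ((TensorRestrictsTo.refl _).kronecker (tensorRestrictsTo_kroneckerPow_add t _ _))
    have s2 := s1.trans_polyDegeneratesTo (h₁.kronecker (h₂.kronecker h₃))
    have s3 : TensorRestrictsTo
        (kroneckerTensor (kroneckerTensor (unitTensor K F) (matMulTensor K A B' C))
          (kroneckerTensor (kroneckerTensor (unitTensor K F) (matMulTensor K B' C A))
            (kroneckerTensor (unitTensor K F) (matMulTensor K C A B'))))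
        (kroneckerTensor (unitTensor K (F * (F * F)))
          (matMulTensor K (A * (B' * C)) (B' * (C * A)) (C * (A * B')))) :=
      ((TensorRestrictsTo.refl _).kronecker
        (tensorRestrictsTo_kronecker_multiple_matMulTensor K F B' C A F C A B')).trans
        (tensorRestrictsTo_kronecker_multiple_matMulTensor K F A B' C (F * F) (B' * C) (C * A) (A * B'))
    have s4 : TensorRestrictsTo
        (kroneckerTensor (unitTensor K (F * (F * F)))
          (matMulTensor K (A * (B' * C)) (B' * (C * A)) (C * (A * B'))))
        (kroneckerTensor (unitTensor K (F ^ 3)) (matMulTensor K Mabc Mabc Mabc)) :=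
      tensorRestrictsTo_multiple_matMulTensor_of_eq K (by ring) (by rw [hM]; ring)
        (by rw [hM]; ring) (by rw [hM]; ring)
    exact (s2.trans_restrictsTo s3).trans_restrictsTo s4
  -- slice ranks: `F³ M² ≤ 3 S(t^{⊗3Nn}) ≤ 18 (3Nn+1)³ B^{3Nn}`
  set e := N * n + (N * n + N * n) with he
  have hepos : 0 < e := by have := Nat.mul_pos hN hn; omega
  have hslice : ((F : ℝ) ^ 3) * ((Mabc : ℝ) ^ 2) ≤ 18 * ((e : ℝ) + 1) ^ 3 * B ^ e := by
    have h1 := mul_sq_le_three_mul_sliceRank_multiple_matMul (K := K) (F ^ 3) Mabc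
    have h2 := hfin.sliceRank_le
    have h3 := hS e hepos
    have h4 : ((F ^ 3 * (Mabc * Mabc) : ℕ) : ℝ) ≤ ((3 * sliceRank (kroneckerPow t e)) : ℕ) := by
      rw [he]; exact_mod_cast h1.trans (Nat.mul_le_mul_left 3 h2)
    push_cast at h4
    nlinarith [h4, h3]
  -- the real bookkeeping
  have hw2 : 2 ≤ w := hw.1
  have hw3 : w ≤ 3 := hw.2
  set Sv := ∑ i, ((a i * b i * c i : ℕ) : ℝ) ^ (w / 3) with hSv
  rcases Nat.eq_zero_or_pos F with hF0 | hF
  · rw [hF0, Nat.cast_zero, zero_mul, mul_zero] at hineq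
    exact hineq.trans (by positivity)
  have hF1 : (1 : ℝ) ≤ F := by exact_mod_cast hF
  have hM0 : (0 : ℝ) ≤ Mabc := Nat.cast_nonneg _
  have step1 : (F : ℝ) * (Mabc : ℝ) ^ (w / 3) ≤ ((F : ℝ) ^ 3 * (Mabc : ℝ) ^ 2) ^ (w / 6) := by
    rw [Real.mul_rpow (by positivity) (by positivity), ← Real.rpow_natCast (F : ℝ) 3,
      ← Real.rpow_mul (by positivity), ← Real.rpow_natCast (Mabc : ℝ) 2, ← Real.rpow_mul hM0]
    have e1 : ((2 : ℕ) : ℝ) * (w / 6) = w / 3 := by push_cast; ring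
    rw [e1]
    refine mul_le_mul_of_nonneg_right ?_ (by positivity)
    calc (F : ℝ) = (F : ℝ) ^ (1 : ℝ) := (Real.rpow_one _).symm
      _ ≤ (F : ℝ) ^ (((3 : ℕ) : ℝ) * (w / 6)) :=
        Real.rpow_le_rpow_of_exponent_le hF1 (by push_cast; linarith)
  have step2 : ((F : ℝ) ^ 3 * (Mabc : ℝ) ^ 2) ^ (w / 6) ≤ (18 * ((e : ℝ) + 1) ^ 3 * B ^ e) ^ (w / 6) :=
    Real.rpow_le_rpow (by positivity) hslice (by linarith)
  -- split the polynomial factor from the base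
  have hX1 : (1 : ℝ) ≤ 18 * ((e : ℝ) + 1) ^ 3 := by
    have : (1 : ℝ) ≤ ((e : ℝ) + 1) ^ 3 := one_le_pow₀ (by linarith [(Nat.cast_nonneg e : (0 : ℝ) ≤ e)])
    linarith
  have step3 : (18 * ((e : ℝ) + 1) ^ 3 * B ^ e) ^ (w / 6) =
      (18 * ((e : ℝ) + 1) ^ 3) ^ (w / 6) * (B ^ (w / 2)) ^ (N * n) := by
    rw [Real.mul_rpow (by positivity) (by positivity), ← Real.rpow_natCast B e, ← Real.rpow_mul hB0,
      ← Real.rpow_mul_natCast hB0]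
    congr 2
    rw [he]; push_cast; ring
  have step4 : (18 * ((e : ℝ) + 1) ^ 3) ^ (w / 6) ≤ 45 * (n : ℝ) ^ 2 * ((N : ℝ) + 1) ^ 2 := by
    have hX := hX1
    set X := (e : ℝ) + 1 with hXdef
    have hX1' : 1 ≤ X := by rw [hXdef]; linarith [(Nat.cast_nonneg e : (0 : ℝ) ≤ e)]
    calc (18 * X ^ 3) ^ (w / 6) ≤ (18 * X ^ 3) ^ ((1 : ℝ) / 2) :=
          Real.rpow_le_rpow_of_exponent_le hX (by linarith)
      _ ≤ ((5 * X ^ 2) ^ 2) ^ ((1 : ℝ) / 2) := by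
          refine Real.rpow_le_rpow (by positivity) ?_ (by norm_num)
          nlinarith [hX1', sq_nonneg X]
      _ = 5 * X ^ 2 := by
          rw [← Real.sqrt_eq_rpow, Real.sqrt_sq (by positivity)]
      _ ≤ 45 * (n : ℝ) ^ 2 * ((N : ℝ) + 1) ^ 2 := by
          have hXle : X ≤ 3 * n * ((N : ℝ) + 1) := by
            rw [hXdef, he]; push_cast; nlinarith
          have hX0 : 0 ≤ X := by linarith
          calc 5 * X ^ 2 ≤ 5 * (3 * n * ((N : ℝ) + 1)) ^ 2 := by
                nlinarith [mul_self_le_mul_self hX0 hXle]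
            _ = 45 * (n : ℝ) ^ 2 * ((N : ℝ) + 1) ^ 2 := by ring
  have hρ0 : 0 ≤ (B ^ (w / 2)) ^ (N * n) := by positivity
  calc Sv ^ N ≤ ((N : ℝ) + 1) ^ p * ((F : ℝ) * ((A * B' * C : ℕ) : ℝ) ^ (w / 3)) := hineq
    _ ≤ ((N : ℝ) + 1) ^ p * ((18 * ((e : ℝ) + 1) ^ 3) ^ (w / 6) * (B ^ (w / 2)) ^ (N * n)) := by
        refine mul_le_mul_of_nonneg_left ?_ (by positivity)
        exact (step1.trans step2).trans step3.le
    _ ≤ ((N : ℝ) + 1) ^ p * ((45 * (n : ℝ) ^ 2 * ((N : ℝ) + 1) ^ 2) * (B ^ (w / 2)) ^ (N * n)) := by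
        refine mul_le_mul_of_nonneg_left ?_ (by positivity)
        exact mul_le_mul_of_nonneg_right step4 hρ0
    _ = 45 * (n : ℝ) ^ 2 * ((N : ℝ) + 1) ^ (p + 2) * (B ^ (w / 2)) ^ (N * n) := by ring

/-- **Qualifying `w` forces `R̃(t) ≤ B^{w/2}`** for a variable-symmetric `t` with finite slice-rank
base `B ≥ 1` (the contradiction `v^{nN} ≤ poly(N) ρ^{nN}`, `v > ρ`, as `N → ∞`).
[cite: Alman2021, Thm. 2.9 (proof)] -/
theorem asymptoticRank_le_rpow_of_qualifying (t : ι → ι → ι → K) (ht : IsVariableSymmetric t)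
    {B : ℝ} (hB1 : 1 ≤ B)
    (hS : ∀ e : ℕ, 0 < e → (sliceRank (kroneckerPow t e) : ℝ) ≤ 6 * ((e : ℝ) + 1) ^ 3 * B ^ e)
    {w : ℝ} (hw : w ∈ Set.Icc (2 : ℝ) 3) (hq : asymptoticRank t ≤ degenerationValue K (w / 3) t) :
    asymptoticRank t ≤ B ^ (w / 2) := by
  classical
  set ρ := B ^ (w / 2) with hρ
  have hρpos : 0 < ρ := Real.rpow_pos_of_pos (zero_lt_one.trans_le hB1) _
  by_contra hlt
  rw [not_le] at hlt
  set 𝒮 := {v : ℝ | ∃ n : ℕ, 0 < n ∧ ∃ (m : ℕ) (a b c : Fin m → ℕ),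
      (∀ i, 0 < a i ∧ 0 < b i ∧ 0 < c i) ∧
        PolyDegeneratesTo (kroneckerPow t n) (matMulDirectSum K a b c) ∧
          v = (∑ i, ((a i * b i * c i : ℕ) : ℝ) ^ (w / 3)) ^ (1 / (n : ℝ))} with h𝒮
  have hq' : asymptoticRank t ≤ sSup 𝒮 := hq
  have hv : ∃ v ∈ 𝒮, ρ < v := by
    by_cases hb : BddAbove 𝒮
    · exact exists_lt_of_lt_csSup ⟨0, zero_mem_degenerationValue_set K (w / 3) t⟩ (hlt.trans_le hq')
    · exact not_bddAbove_iff.1 hb ρ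
  obtain ⟨v, ⟨n, hn, p, a, b, c, hpos, hdeg, rfl⟩, hρv⟩ := hv
  set Sv := ∑ i, ((a i * b i * c i : ℕ) : ℝ) ^ (w / 3) with hSv
  have hSv0 : 0 ≤ Sv := Finset.sum_nonneg fun i _ => by positivity
  have hn0 : n ≠ 0 := hn.ne'
  have hρn : ρ ^ n < Sv := by
    have := pow_lt_pow_left₀ hρv hρpos.le hn0
    rwa [one_div, Real.rpow_inv_natCast_pow hSv0 hn0] at this
  have hρn0 : 0 < ρ ^ n := pow_pos hρpos n
  set α := Sv / ρ ^ n with hα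
  have hα1 : 1 < α := (one_lt_div hρn0).2 hρn
  have hα0 : 0 < α := zero_lt_one.trans hα1
  set Cn : ℝ := 45 * (n : ℝ) ^ 2 with hCn
  have hnpos : (0 : ℝ) < n := by exact_mod_cast hn
  have hCn0 : 0 < Cn := by rw [hCn]; positivity
  have hpow : ∀ N : ℕ, α ^ N ≤ Cn * ((N : ℝ) + 1) ^ (p + 2) := by
    intro N
    have h := sum_rpow_pow_le_of_sliceRank_pow_le K t ht hn hpos hdeg hw hB1 hS N
    rw [← hSv, ← hρ] at h
    rw [hα, div_pow, div_le_iff₀ (pow_pos hρn0 N)]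
    calc Sv ^ N ≤ 45 * (n : ℝ) ^ 2 * ((N : ℝ) + 1) ^ (p + 2) * ρ ^ (N * n) := h
      _ = Cn * ((N : ℝ) + 1) ^ (p + 2) * (ρ ^ n) ^ N := by rw [hCn, ← pow_mul, mul_comm n N]
  have hlim : Tendsto (fun N : ℕ => (((N + 1 : ℕ) : ℝ)) ^ (p + 2) / α ^ (N + 1)) atTop (𝓝 0) :=
    (tendsto_pow_const_div_const_pow_of_one_lt (p + 2) hα1).comp (tendsto_add_atTop_nat 1)
  have hsmall : (0 : ℝ) < 1 / (Cn * α) := by positivity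
  obtain ⟨N, hN⟩ := (hlim.eventually (gt_mem_nhds hsmall)).exists
  rw [div_lt_div_iff₀ (by positivity) (by positivity), one_mul, pow_succ α N] at hN
  have h2 := mul_le_mul_of_nonneg_right (hpow N) hα0.le
  push_cast at hN
  have h3 : ((N : ℝ) + 1) ^ (p + 2) * (Cn * α) = Cn * ((N : ℝ) + 1) ^ (p + 2) * α := by ring
  linarith

end Core

/-! ## The bound on `ω_u(CW_q)` from a certified base -/

section CwBound

/-- **`ω_u(CW_q) ≥ min(3, 2 log(q+2)/log B)`** for every base `B > 1` with `g_q ≤ B` on `[0,1/3]`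
(Alman 2021, §4.1: "we can apply Theorem 2.9 to give lower bounds
`ω_u(CW_q) ≥ 2 log(q+2)/log S̃(CW_q)`", here with the finite bound of
`sliceRank_cwPow_le` in place of `S̃`). [cite: Alman2021, Thm. 1.3 (proof, §4.1)] -/
theorem min_le_universalOmega_bigCwTensor (K : Type) [Field K] (q : ℕ) (B : ℝ) (hB1 : 1 < B)
    (hB : ∀ v ∈ Set.Icc (0 : ℝ) (1 / 3), cwBase q v ≤ B) :
    min 3 (2 * Real.log ((q : ℝ) + 2) / Real.log B) ≤ universalOmega K (bigCwTensor K q) := by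
  have hlogB : 0 < Real.log B := Real.log_pos hB1
  have hS : ∀ e : ℕ, 0 < e → (sliceRank (kroneckerPow (bigCwTensor K q) e) : ℝ) ≤
      6 * ((e : ℝ) + 1) ^ 3 * B ^ e := by
    intro e he
    refine (sliceRank_cwPow_le (K := K) q e he B hB).trans ?_
    have h1 : (1 : ℝ) ≤ ((e : ℝ) + 1) ^ 3 * B ^ e :=
      one_le_mul_of_one_le_of_one_le (one_le_pow₀ (by linarith [(Nat.cast_nonneg e : (0 : ℝ) ≤ e)]))
        (one_le_pow₀ hB1.le)
    linarith
  refine le_csInf ⟨3, Set.mem_union_right _ (Set.mem_singleton _)⟩ ?_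
  rintro w (⟨hw, hq⟩ | hw3)
  · refine (min_le_right _ _).trans ?_
    have h1 := asymptoticRank_le_rpow_of_qualifying K (bigCwTensor K q)
      (isVariableSymmetric_bigCwTensor q) hB1.le hS hw hq
    have h2 := (le_asymptoticRank_bigCwTensor (K := K) q).trans h1
    have hq2 : (0 : ℝ) < (q : ℝ) + 2 := by positivity
    have h3 := Real.log_le_log hq2 h2
    rw [Real.log_rpow (zero_lt_one.trans hB1)] at h3
    rw [div_le_iff₀ hlogB]
    linarith
  · rw [Set.mem_singleton_iff.1 hw3]
    exact min_le_left _ _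

end CwBound


end Literature.Barriers.MatrixMultiplication

end
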